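import Literature.NumberTheory.CubicFields.CubicFieldDiscriminant2071
import HarnessLib

/-!
# The cubic field of discriminant `−2071`, II: the primes of norm `≤ 12` and ★ class number ONE — `2 = 𝔭_a𝔭_b𝔭_c` with principal `𝔭`'s generated by
# `-16 − θ + δ`, `-85 − 76θ + 25δ`, `-23 − 25θ + 8δ` (Dedekind's splitting), the odd primes by Dedekind–Kummer through `θ`

Sequel of `CubicFieldDiscriminant2071.lean` (att-p4 g46, cell `bsd-f1-sign2`).  THEOREMS ONLY.  The Minkowski bound of `F` (`d_F = −2071`, signature `(1,1)`) is
`(4/π)(6/27)√2071 < 13`; the primes above `2` are the three principal primes generated by the norm-`±2` elements above (their product is `2` times a unit; norms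
by the norm form on `1, α, α²`), and every prime of norm `≤ 12` above an odd `p` is principal by Dedekind–Kummer through `θ` (`p ∤ 2 ⊇ [𝓞_F : ℤ[θ]]`) with explicit
generators.  Hence `𝓞_F` is a PID and ★ `h_F = 1` — the datum `2 ∤ h(ℚ(β))` of the split-stratum doors of route `AlignedTransportAtTwo`.
[cite: Marcus2018, Ch. 3, Thm. 27 and Exercise 21; Ch. 5, Thm. 37 and Cor. 2] [cite: LMFDB, number field 3.1.2071.1 (class number 1)]
-/

noncomputable section

open Polynomial NumberField NumberField.InfinitePlace Ideal Module Real
open Literature.NumberTheory.NumberFields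
open Literature.NumberTheory.NumberFields.MonicCubic

namespace Literature.NumberTheory.CubicFields.CubicDisc2071

section NumberField

variable {F : Type*} [Field F] [NumberField F] {α : F}

/-! ## §3 The primes of norm `≤ 12` are principal -/

/-- `N(-16 - θ + δ) = 2` (norm form on `1, α, α²`; `δ = (α ^ 2 + α) / 2`). [cite: Marcus2018, Ch. 2, Thm. 4 and Exercise 13] -/
theorem natAbs_norm_piA (h3 : finrank ℚ F = 3) (hα : aeval α (poly (-5) (-6) (-8)) = 0) :
    (Algebra.norm ℤ (-16 - thetaInt hα + thetaInt (delta_root hα) : 𝓞 F)).natAbs = 2 := by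
  have h : ((Algebra.norm ℤ (-16 - thetaInt hα + thetaInt (delta_root hα) : 𝓞 F) : ℤ) : ℚ) = Algebra.norm ℚ (algebraMap (𝓞 F) F (-16 - thetaInt hα + thetaInt (delta_root hα))) :=
    Algebra.coe_norm_int _
  have hx : algebraMap (𝓞 F) F (-16 - thetaInt hα + thetaInt (delta_root hα)) = ((-16 : ℚ) : F) + ((-1/2 : ℚ) : F) * α + ((1/2 : ℚ) : F) * α ^ 2 := by
    simp only [map_add, map_sub, map_neg, map_ofNat, MonicCubic.thetaInt, RingOfIntegers.map_mk]
    push_cast; ring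
  rw [hx, norm_lin irreducible_polyQ hα h3] at h
  have hn : normForm (-5) (-6) (-8) (-16) (-1/2) (1/2) = ((2 : ℤ) : ℚ) := by norm_num [normForm]
  rw [hn] at h
  have h' : Algebra.norm ℤ (-16 - thetaInt hα + thetaInt (delta_root hα) : 𝓞 F) = 2 := by exact_mod_cast h
  rw [h']; rfl

/-- `-16 - θ + δ` is a prime element of `𝓞_F` (norm `2`). [cite: Marcus2018, Ch. 3, Thm. 27] -/
theorem prime_piA (h3 : finrank ℚ F = 3) (hα : aeval α (poly (-5) (-6) (-8)) = 0) : Prime (-16 - thetaInt hα + thetaInt (delta_root hα) : 𝓞 F) :=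
  prime_of_natAbs_norm_prime (by rw [natAbs_norm_piA h3 hα]; norm_num)

/-- `N(-85 - 76 * θ + 25 * δ) = 2` (norm form on `1, α, α²`; `δ = (α ^ 2 + α) / 2`). [cite: Marcus2018, Ch. 2, Thm. 4 and Exercise 13] -/
theorem natAbs_norm_piB (h3 : finrank ℚ F = 3) (hα : aeval α (poly (-5) (-6) (-8)) = 0) :
    (Algebra.norm ℤ (-85 - 76 * thetaInt hα + 25 * thetaInt (delta_root hα) : 𝓞 F)).natAbs = 2 := by
  have h : ((Algebra.norm ℤ (-85 - 76 * thetaInt hα + 25 * thetaInt (delta_root hα) : 𝓞 F) : ℤ) : ℚ) = Algebra.norm ℚ (algebraMap (𝓞 F) F (-85 - 76 * thetaInt hα + 25 * thetaInt (delta_root hα))) :=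
    Algebra.coe_norm_int _
  have hx : algebraMap (𝓞 F) F (-85 - 76 * thetaInt hα + 25 * thetaInt (delta_root hα)) = ((-85 : ℚ) : F) + ((-127/2 : ℚ) : F) * α + ((25/2 : ℚ) : F) * α ^ 2 := by
    simp only [map_mul, map_add, map_sub, map_neg, map_ofNat, MonicCubic.thetaInt, RingOfIntegers.map_mk]
    push_cast; ring
  rw [hx, norm_lin irreducible_polyQ hα h3] at h
  have hn : normForm (-5) (-6) (-8) (-85) (-127/2) (25/2) = ((2 : ℤ) : ℚ) := by norm_num [normForm]
  rw [hn] at h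
  have h' : Algebra.norm ℤ (-85 - 76 * thetaInt hα + 25 * thetaInt (delta_root hα) : 𝓞 F) = 2 := by exact_mod_cast h
  rw [h']; rfl

/-- `-85 - 76 * θ + 25 * δ` is a prime element of `𝓞_F` (norm `2`). [cite: Marcus2018, Ch. 3, Thm. 27] -/
theorem prime_piB (h3 : finrank ℚ F = 3) (hα : aeval α (poly (-5) (-6) (-8)) = 0) : Prime (-85 - 76 * thetaInt hα + 25 * thetaInt (delta_root hα) : 𝓞 F) :=
  prime_of_natAbs_norm_prime (by rw [natAbs_norm_piB h3 hα]; norm_num)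

/-- `N(-23 - 25 * θ + 8 * δ) = -2` (norm form on `1, α, α²`; `δ = (α ^ 2 + α) / 2`). [cite: Marcus2018, Ch. 2, Thm. 4 and Exercise 13] -/
theorem natAbs_norm_piC (h3 : finrank ℚ F = 3) (hα : aeval α (poly (-5) (-6) (-8)) = 0) :
    (Algebra.norm ℤ (-23 - 25 * thetaInt hα + 8 * thetaInt (delta_root hα) : 𝓞 F)).natAbs = 2 := by
  have h : ((Algebra.norm ℤ (-23 - 25 * thetaInt hα + 8 * thetaInt (delta_root hα) : 𝓞 F) : ℤ) : ℚ) = Algebra.norm ℚ (algebraMap (𝓞 F) F (-23 - 25 * thetaInt hα + 8 * thetaInt (delta_root hα))) :=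
    Algebra.coe_norm_int _
  have hx : algebraMap (𝓞 F) F (-23 - 25 * thetaInt hα + 8 * thetaInt (delta_root hα)) = ((-23 : ℚ) : F) + ((-21 : ℚ) : F) * α + ((4 : ℚ) : F) * α ^ 2 := by
    simp only [map_mul, map_add, map_sub, map_neg, map_ofNat, MonicCubic.thetaInt, RingOfIntegers.map_mk]
    push_cast; ring
  rw [hx, norm_lin irreducible_polyQ hα h3] at h
  have hn : normForm (-5) (-6) (-8) (-23) (-21) (4) = ((-2 : ℤ) : ℚ) := by norm_num [normForm]
  rw [hn] at h
  have h' : Algebra.norm ℤ (-23 - 25 * thetaInt hα + 8 * thetaInt (delta_root hα) : 𝓞 F) = -2 := by exact_mod_cast h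
  rw [h']; rfl

/-- `-23 - 25 * θ + 8 * δ` is a prime element of `𝓞_F` (norm `-2`). [cite: Marcus2018, Ch. 3, Thm. 27] -/
theorem prime_piC (h3 : finrank ℚ F = 3) (hα : aeval α (poly (-5) (-6) (-8)) = 0) : Prime (-23 - 25 * thetaInt hα + 8 * thetaInt (delta_root hα) : 𝓞 F) :=
  prime_of_natAbs_norm_prime (by rw [natAbs_norm_piC h3 hα]; norm_num)

/-- **`2` splits completely**: `(-16 - θ + δ)·(-85 - 76 * θ + 25 * δ)·(-23 - 25 * θ + 8 * δ) = (2897 - 18362 * θ + 4984 * δ)·2` (the cofactor is a unit). [cite: Marcus2018, Ch. 3, Thm. 27 and Exercise 21 (Dedekind)] -/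
theorem prod_dyadic_eq (hα : aeval α (poly (-5) (-6) (-8)) = 0) :
    (-16 - thetaInt hα + thetaInt (delta_root hα) : 𝓞 F) * (-85 - 76 * thetaInt hα + 25 * thetaInt (delta_root hα)) * (-23 - 25 * thetaInt hα + 8 * thetaInt (delta_root hα)) = (2897 - 18362 * thetaInt hα + 4984 * thetaInt (delta_root hα)) * (((2 : ℕ) : ℤ) : 𝓞 F) := by
  rw [RingOfIntegers.ext_iff]
  simp only [map_mul, map_add, map_sub, map_neg, map_ofNat, map_intCast, MonicCubic.thetaInt, RingOfIntegers.map_mk]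
  push_cast
  linear_combination (((18537 : F) / 4) + ((-830 : F)) * α + ((-633 : F) / 4) * α ^ 2 + ((25 : F)) * α ^ 3) * cubic_eq hα

/-- **Every prime of `𝓞_F` above `2` is principal**: `2` is the product of the three prime elements above (up to a unit), so a prime `P ∋ 2` is one of
the three principal primes `(π)`. [cite: Marcus2018, Ch. 3, Thm. 27 and Exercise 21] [cite: LMFDB, number field 3.1.2071.1 (class number 1)] -/
theorem isPrincipal_of_mem_primesOver_2 (h3 : finrank ℚ F = 3) (hα : aeval α (poly (-5) (-6) (-8)) = 0) {P : Ideal (𝓞 F)}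
    (hP : P ∈ primesOver (span {((2 : ℕ) : ℤ)}) (𝓞 F)) : Submodule.IsPrincipal P := by
  haveI := hP.1
  have h2 : (((2 : ℕ) : ℤ) : 𝓞 F) ∈ P := by
    have hu : ((2 : ℕ) : ℤ) ∈ P.under ℤ := by
      rw [← hP.2.over]; exact Ideal.mem_span_singleton_self _
    exact hu
  have hmem : (-16 - thetaInt hα + thetaInt (delta_root hα) : 𝓞 F) * (-85 - 76 * thetaInt hα + 25 * thetaInt (delta_root hα)) * (-23 - 25 * thetaInt hα + 8 * thetaInt (delta_root hα)) ∈ P := by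
    rw [prod_dyadic_eq hα]; exact P.mul_mem_left _ h2
  rcases eq_span_singleton_of_prod_mem hP.1 (prime_piA h3 hα) (prime_piB h3 hα) (prime_piC h3 hα) hmem with h | h | h
  · exact ⟨⟨_, by rw [h, Ideal.submodule_span_eq]⟩⟩
  · exact ⟨⟨_, by rw [h, Ideal.submodule_span_eq]⟩⟩
  · exact ⟨⟨_, by rw [h, Ideal.submodule_span_eq]⟩⟩

/-- `(3, θ + 2) = (1 + 2 * δ)`, an element of norm `3` (identities checked in `F`, `δ = (α ^ 2 + α) / 2`).
[cite: Marcus2018, Ch. 3, Thm. 27] -/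
theorem span_3_lin2_eq (hα : aeval α (poly (-5) (-6) (-8)) = 0) :
    span {(3 : 𝓞 F), thetaInt hα + 2} = span {1 + 2 * thetaInt (delta_root hα)} := by
  apply le_antisymm
  · rw [span_le]
    rintro x hx
    rcases hx with rfl | hx
    · exact mem_span_singleton'.mpr ⟨-5 + 8 * thetaInt hα - 2 * thetaInt (delta_root hα), by
          rw [RingOfIntegers.ext_iff]
          simp only [map_mul, map_add, map_sub, map_neg, map_ofNat, map_one, MonicCubic.thetaInt, RingOfIntegers.map_mk]
          linear_combination (((1 : F)) + ((-1 : F)) * α) * cubic_eq hα⟩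
    · rw [Set.mem_singleton_iff.mp hx]
      exact mem_span_singleton'.mpr ⟨-6 + thetaInt hα, by
          rw [RingOfIntegers.ext_iff]
          simp only [map_mul, map_add, map_neg, map_ofNat, map_one, MonicCubic.thetaInt, RingOfIntegers.map_mk]
          linear_combination (((1 : F))) * cubic_eq hα⟩
  · rw [span_singleton_le_iff_mem, mem_span_pair]
    exact ⟨1, -1 + thetaInt hα, by
        rw [RingOfIntegers.ext_iff]
        simp only [map_mul, map_add, map_neg, map_ofNat, map_one, MonicCubic.thetaInt, RingOfIntegers.map_mk]
        linear_combination (0 : F) * cubic_eq hα⟩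

/-- `(3, θ ^ 2 + 2 * θ + 2) = (-5 + 8 * θ - 2 * δ)`, an element of norm `9` (identities checked in `F`, `δ = (α ^ 2 + α) / 2`).
[cite: Marcus2018, Ch. 3, Thm. 27] -/
theorem span_3_quad_eq (hα : aeval α (poly (-5) (-6) (-8)) = 0) :
    span {(3 : 𝓞 F), thetaInt hα ^ 2 + 2 * thetaInt hα + 2} = span {-5 + 8 * thetaInt hα - 2 * thetaInt (delta_root hα)} := by
  apply le_antisymm
  · rw [span_le]
    rintro x hx
    rcases hx with rfl | hx
    · exact mem_span_singleton'.mpr ⟨1 + 2 * thetaInt (delta_root hα), by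
          rw [RingOfIntegers.ext_iff]
          simp only [map_mul, map_add, map_sub, map_neg, map_ofNat, map_one, MonicCubic.thetaInt, RingOfIntegers.map_mk]
          linear_combination (((1 : F)) + ((-1 : F)) * α) * cubic_eq hα⟩
    · rw [Set.mem_singleton_iff.mp hx]
      exact mem_span_singleton'.mpr ⟨22 + 3 * thetaInt hα + 34 * thetaInt (delta_root hα), by
          rw [RingOfIntegers.ext_iff]
          simp only [map_mul, map_add, map_sub, map_neg, map_pow, map_ofNat, MonicCubic.thetaInt, RingOfIntegers.map_mk]
          linear_combination (((14 : F)) + ((-17 : F)) * α) * cubic_eq hα⟩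
  · rw [span_singleton_le_iff_mem, mem_span_pair]
    exact ⟨-5 + thetaInt hα - 4 * thetaInt (delta_root hα), 5, by
        rw [RingOfIntegers.ext_iff]
        simp only [map_mul, map_add, map_sub, map_neg, map_pow, map_ofNat, MonicCubic.thetaInt, RingOfIntegers.map_mk]
        linear_combination (0 : F) * cubic_eq hα⟩

/-- **Every prime of `𝓞_F` above `3` is principal** (Dedekind–Kummer through `θ`, `3 ∤ exponent`, with `polyMod_3` and the generators above).
[cite: Marcus2018, Ch. 3, Thm. 27] [cite: LMFDB, number field 3.1.2071.1 (class number 1)] -/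
theorem isPrincipal_of_mem_primesOver_3 (h3 : finrank ℚ F = 3) (hα : aeval α (poly (-5) (-6) (-8)) = 0) {P : Ideal (𝓞 F)}
    (hP : P ∈ primesOver (span {((3 : ℕ) : ℤ)}) (𝓞 F)) : Submodule.IsPrincipal P := by
  haveI : Fact (Nat.Prime 3) := ⟨by norm_num⟩
  obtain ⟨Qb, hirr, hmon, hdvd, -, hspan⟩ :=
    exists_factor_of_mem_primesOver' irreducible_polyQ hα (by norm_num : Nat.Prime 3)
      (not_dvd_exponent h3 hα (by norm_num) (by norm_num)) hP
  rw [polyMod_3] at hdvd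
  rcases hirr.prime.dvd_or_dvd hdvd with h | h
  · have hirr1 : Irreducible (X + 2 : (ZMod 3)[X]) := by
      rw [show (X + 2 : (ZMod 3)[X]) = X - C (-2) by rw [map_neg, map_ofNat]; ring]
      exact irreducible_X_sub_C _
    have hQb : Qb = X + 2 := eq_of_monic_of_associated hmon (by monicity!) (hirr.associated_of_dvd hirr1 h)
    have hPeq := hspan (X + C 2) (by rw [hQb]; simp [map_ofNat])
    rw [show aeval (thetaInt hα) (X + C 2 : ℤ[X]) = thetaInt hα + 2 by
        simp only [map_add, aeval_X, aeval_C, algebraMap_int_eq, Int.coe_castRingHom, Int.cast_ofNat], Nat.cast_ofNat, span_3_lin2_eq hα] at hPeq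
    exact ⟨⟨1 + 2 * thetaInt (delta_root hα), by rw [hPeq, Ideal.submodule_span_eq]⟩⟩
  · have hQb : Qb = X ^ 2 + 2 * X + 2 :=
      eq_of_monic_of_associated hmon (by monicity!) (hirr.associated_of_dvd irreducible_quad_3 h)
    have hPeq := hspan (X ^ 2 + 2 * X + 2) (by rw [hQb]; simp)
    rw [show aeval (thetaInt hα) (X ^ 2 + 2 * X + 2 : ℤ[X]) = thetaInt hα ^ 2 + 2 * thetaInt hα + 2 by
        simp only [map_add, map_pow, aeval_X, map_mul, map_ofNat, map_ofNat], Nat.cast_ofNat, span_3_quad_eq hα] at hPeq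
    exact ⟨⟨-5 + 8 * thetaInt hα - 2 * thetaInt (delta_root hα), by rw [hPeq, Ideal.submodule_span_eq]⟩⟩

/-- **Every prime of `𝓞_F` above `5` is principal**: `5` is inert (`f` irreducible mod `5`, `5 ∤ exponent`), so `P = (5)`.
[cite: Marcus2018, Ch. 3, Thm. 27] [cite: LMFDB, number field 3.1.2071.1 (class number 1)] -/
theorem isPrincipal_of_mem_primesOver_5 (h3 : finrank ℚ F = 3) (hα : aeval α (poly (-5) (-6) (-8)) = 0) {P : Ideal (𝓞 F)}
    (hP : P ∈ primesOver (span {((5 : ℕ) : ℤ)}) (𝓞 F)) : Submodule.IsPrincipal P := by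
  have hPeq := eq_span_of_no_root' irreducible_polyQ hα (by norm_num : Nat.Prime 5)
    (not_dvd_exponent h3 hα (by norm_num) (by norm_num)) hP no_root_5
  exact ⟨⟨((5 : ℕ) : 𝓞 F), by rw [hPeq, Ideal.submodule_span_eq]⟩⟩

/-- `f` has no root modulo `7`. [cite: Marcus2018, Ch. 3, Thm. 27] -/
theorem no_root_7' :
    ∀ r : ZMod 7, r ^ 3 + ((-5 : ℤ) : ZMod 7) * r ^ 2 + ((-6 : ℤ) : ZMod 7) * r + ((-8 : ℤ) : ZMod 7) ≠ 0 := by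
  decide

/-- **Every prime of `𝓞_F` above `7` is principal**: `7` is inert (`f` irreducible mod `7`, `7 ∤ exponent`), so `P = (7)`.
[cite: Marcus2018, Ch. 3, Thm. 27] [cite: LMFDB, number field 3.1.2071.1 (class number 1)] -/
theorem isPrincipal_of_mem_primesOver_7 (h3 : finrank ℚ F = 3) (hα : aeval α (poly (-5) (-6) (-8)) = 0) {P : Ideal (𝓞 F)}
    (hP : P ∈ primesOver (span {((7 : ℕ) : ℤ)}) (𝓞 F)) : Submodule.IsPrincipal P := by
  have hPeq := eq_span_of_no_root' irreducible_polyQ hα (by norm_num : Nat.Prime 7)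
    (not_dvd_exponent h3 hα (by norm_num) (by norm_num)) hP no_root_7'
  exact ⟨⟨((7 : ℕ) : 𝓞 F), by rw [hPeq, Ideal.submodule_span_eq]⟩⟩

/-- `(11, θ + 8) = (-77 + 34 * θ - 6 * δ)`, an element of norm `11` (identities checked in `F`, `δ = (α ^ 2 + α) / 2`).
[cite: Marcus2018, Ch. 3, Thm. 27] -/
theorem span_11_lin8_eq (hα : aeval α (poly (-5) (-6) (-8)) = 0) :
    span {(11 : 𝓞 F), thetaInt hα + 8} = span {-77 + 34 * thetaInt hα - 6 * thetaInt (delta_root hα)} := by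
  apply le_antisymm
  · rw [span_le]
    rintro x hx
    rcases hx with rfl | hx
    · exact mem_span_singleton'.mpr ⟨273 + 38 * thetaInt hα + 422 * thetaInt (delta_root hα), by
          rw [RingOfIntegers.ext_iff]
          simp only [map_mul, map_add, map_sub, map_neg, map_ofNat, MonicCubic.thetaInt, RingOfIntegers.map_mk]
          linear_combination (((2629 : F)) + ((-633 : F)) * α) * cubic_eq hα⟩
    · rw [Set.mem_singleton_iff.mp hx]
      exact mem_span_singleton'.mpr ⟨352 + 49 * thetaInt hα + 544 * thetaInt (delta_root hα), by
          rw [RingOfIntegers.ext_iff]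
          simp only [map_mul, map_add, map_sub, map_neg, map_ofNat, MonicCubic.thetaInt, RingOfIntegers.map_mk]
          linear_combination (((3389 : F)) + ((-816 : F)) * α) * cubic_eq hα⟩
  · rw [span_singleton_le_iff_mem, mem_span_pair]
    exact ⟨77 + 380 * thetaInt (delta_root hα), 34 - 299 * thetaInt (delta_root hα), by
        rw [RingOfIntegers.ext_iff]
        simp only [map_mul, map_add, map_sub, map_neg, map_ofNat, MonicCubic.thetaInt, RingOfIntegers.map_mk]
        linear_combination (((-299 : F) / 2)) * cubic_eq hα⟩

/-- **Every prime of `𝓞_F` above `11` with `11^f ≤ 12` is principal** (Dedekind–Kummer through `θ`, `11 ∤ exponent`, with `polyMod_11` and the generators above).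
[cite: Marcus2018, Ch. 3, Thm. 27] [cite: LMFDB, number field 3.1.2071.1 (class number 1)] -/
theorem isPrincipal_of_mem_primesOver_11 (h3 : finrank ℚ F = 3) (hα : aeval α (poly (-5) (-6) (-8)) = 0) {P : Ideal (𝓞 F)}
    (hP : P ∈ primesOver (span {((11 : ℕ) : ℤ)}) (𝓞 F))
    (hle : 11 ^ P.inertiaDeg ℤ ≤ 12) : Submodule.IsPrincipal P := by
  haveI : Fact (Nat.Prime 11) := ⟨by norm_num⟩
  obtain ⟨Qb, hirr, hmon, hdvd, hdeg, hspan⟩ :=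
    exists_factor_of_mem_primesOver' irreducible_polyQ hα (by norm_num : Nat.Prime 11)
      (not_dvd_exponent h3 hα (by norm_num) (by norm_num)) hP
  rw [polyMod_11] at hdvd
  rcases hirr.prime.dvd_or_dvd hdvd with h | h
  · have hirr1 : Irreducible (X + 8 : (ZMod 11)[X]) := by
      rw [show (X + 8 : (ZMod 11)[X]) = X - C (-8) by rw [map_neg, map_ofNat]; ring]
      exact irreducible_X_sub_C _
    have hQb : Qb = X + 8 := eq_of_monic_of_associated hmon (by monicity!) (hirr.associated_of_dvd hirr1 h)
    have hPeq := hspan (X + C 8) (by rw [hQb]; simp [map_ofNat])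
    rw [show aeval (thetaInt hα) (X + C 8 : ℤ[X]) = thetaInt hα + 8 by
        simp only [map_add, aeval_X, aeval_C, algebraMap_int_eq, Int.coe_castRingHom, Int.cast_ofNat], Nat.cast_ofNat, span_11_lin8_eq hα] at hPeq
    exact ⟨⟨-77 + 34 * thetaInt hα - 6 * thetaInt (delta_root hα), by rw [hPeq, Ideal.submodule_span_eq]⟩⟩
  · have hQb : Qb = X ^ 2 + 9 * X + 10 :=
      eq_of_monic_of_associated hmon (by monicity!) (hirr.associated_of_dvd irreducible_quad_11 h)
    exfalso
    have hd2 : (X ^ 2 + 9 * X + 10 : (ZMod 11)[X]).natDegree = 2 := by compute_degree!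
    rw [hdeg, hQb, hd2] at hle
    norm_num at hle

/-! ## §4 Class number one -/

/-- **`𝓞_F` is a principal ideal domain.**  Minkowski: every ideal class contains an ideal of norm `≤ (4/π)(6/27)√2071 < 13`, and the primes
`P` above `p ≤ 12` with `p^f ≤ 12` are principal (§3). [cite: LMFDB, number field 3.1.2071.1 (class number 1)] [cite: Marcus2018, Ch. 5, Thm. 37 and Cor. 2] -/
theorem isPrincipalIdealRing (h3 : finrank ℚ F = 3) (hα : aeval α (poly (-5) (-6) (-8)) = 0) : IsPrincipalIdealRing (𝓞 F) := by
  apply RingOfIntegers.isPrincipalIdealRing_of_isPrincipal_of_pow_le_of_mem_primesOver_of_mem_Icc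
  rw [nrComplexPlaces_eq_one h3 hα, h3, discr_eq h3 hα]
  intro p hp hpr P hP hle
  obtain ⟨hp1, hpM⟩ := Finset.mem_Icc.mp hp
  have hreal : (4 / π) ^ 1 * ((((3 : ℕ).factorial : ℕ) : ℝ) / ((3 : ℕ) : ℝ) ^ (3 : ℕ) * √|((-2071 : ℤ) : ℝ)|) < ((13 : ℕ) : ℝ) := by
    have hπ := Real.pi_gt_d2
    have hπ0 := Real.pi_pos
    have hs : √(2071 : ℝ) < 45.51 := by
      rw [Real.sqrt_lt' (by norm_num)]; norm_num
    have hs0 : 0 ≤ √(2071 : ℝ) := Real.sqrt_nonneg _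
    have habs : |((-2071 : ℤ) : ℝ)| = 2071 := by norm_num
    rw [habs]
    norm_num [Nat.factorial]
    rw [div_mul_eq_mul_div, div_lt_iff₀ hπ0]
    nlinarith
  have hfl := Nat.lt_succ_iff.mp ((Nat.floor_lt' (by norm_num)).mpr hreal)
  have hpB : p ≤ 12 := hpM.trans hfl
  have hleB : p ^ P.inertiaDeg ℤ ≤ 12 := hle.trans hfl
  clear hpM hle hp
  interval_cases p
  · exact absurd hpr (by norm_num)
  · exact isPrincipal_of_mem_primesOver_2 h3 hα hP
  · exact isPrincipal_of_mem_primesOver_3 h3 hα hP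
  · exact absurd hpr (by norm_num)
  · exact isPrincipal_of_mem_primesOver_5 h3 hα hP
  · exact absurd hpr (by norm_num)
  · exact isPrincipal_of_mem_primesOver_7 h3 hα hP
  · exact absurd hpr (by norm_num)
  · exact absurd hpr (by norm_num)
  · exact absurd hpr (by norm_num)
  · exact isPrincipal_of_mem_primesOver_11 h3 hα hP hleB
  · exact absurd hpr (by norm_num)

/-- ★ **`h_F = 1`: the cubic field of discriminant `−2071` has class number one** (`𝓞_F = ℤ ⊕ ℤθ ⊕ ℤδ`, no power integral basis found).
[cite: LMFDB, number field 3.1.2071.1 (class number 1)] -/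
theorem classNumber_eq_one (h3 : finrank ℚ F = 3) (hα : aeval α (poly (-5) (-6) (-8)) = 0) : classNumber F = 1 :=
  (classNumber_eq_one_iff (K := F)).mpr (isPrincipalIdealRing h3 hα)

/-- **`h_F` is odd** (the form consumed by the `2`-adic doors of cell `bsd-f1-sign2`). [cite: LMFDB, number field 3.1.2071.1 (class number 1)] -/
theorem not_two_dvd_classNumber (h3 : finrank ℚ F = 3) (hα : aeval α (poly (-5) (-6) (-8)) = 0) : ¬ 2 ∣ classNumber F := by
  rw [classNumber_eq_one h3 hα]; decide

end NumberField

end Literature.NumberTheory.CubicFields.CubicDisc2071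

end
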